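/-
Copyright (c) 2026 the pub-hodgecm-mathlib formalisation cell (harness21).  Prover seat hodgecm-mathlib-R90-CS-p03 (g0) for R90-TF section S8 «ContSpec-n½» (planner R90-CS-plan (g2), deal
(B-1) S8-R24 16:52:09Z): the `U(2,1)` twin of ★ `K2E1ChiEisensteinMeromorphicExportsU2Global` (X2_χ core) together with the `N = 3` twin of its ★ row-13 input
`K2E1ChiEisensteinMeromorphicU2.chiEisenstein_meromorphic_globalPoleSet_of_balls` (TWIN-DAG v1 row 6 feed).
-/
import Summits.HodgeConjecture.HodgeConjecture.Theorems.K2E1SphericalEisensteinMeromorphicExportsU3Global  -- ★ the spherical `N = 3` template: brings ★ `K2E1BLMeromorphicFamilyByproductsU` (`exists_global_pole_set_of_lt`), ★ `K2E1BorelEisensteinRegularCMThree` (`…_cm_three` holomorphy∕continuity), ★ P3-D `exists_evalCLM`, ★ X2a `continuous_integral_mul_lift`, ★ `quotFun_lift`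
import HarnessLib

/-!
# K2·E1 ∕ R90·S8 — `K2E1ChiEisensteinMeromorphicExportsU3Global` ((B-1), TWIN-DAG row 6 feed): THE GLOBAL EXPORTS CORE OF A `χ`-EISENSTEIN FAMILY OF `U(2,1)`, HYPOTHESIS-FIRST ON THE
# PER-BALL PACKAGES — and the `N = 3` common-pole-set gluing it rests on

Cell `pub/hodgecm-mathlib`, crux h413 = `stmt-HodgeConjecture-24833`, route of record `HCCMUnconditional`; R90-TF section S8 «ContSpec-n½» (the `U(Φ₃)` χ-twin programme, K2E1-p16's
TWIN-DAG v1 row 6; consumer: `K2E1ChiEisensteinMeromorphicExportsU3GlobalCM` after row 5 part 3).  THEOREMS ONLY (no `def`, no `instance`, no notation, no named-fact hypothesis, no `sorry`;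
default heartbeats); lane `--supports stmt-HodgeConjecture-24833 --as helper` (count-neutral).  Closes no socket.

THE TWIN ([BernsteinLapid2019] Thm 2.3, §2.1, §2.4, §4; [MoeglinWaldspurger1995] IV.1.8–IV.1.10).  ★ `K2E1ChiEisensteinMeromorphicExportsU2Global` glues the per-ball meromorphic pieces of
a `χ`-Eisenstein family of `U(1,1)` into ONE family `Ec` with ONE closed co-discrete pole set `P ⊆ {Re ≤ 1}` (★ row 13) and reads off (E5) the pointwise representation at the evaluation
functionals and (E4) the continuity in `g`.  Every engine is rank-generic EXCEPT two `N = 2` pins: (a) ★ row 13 `chiEisenstein_meromorphic_globalPoleSet_of_balls` (threshold `1 < Re`,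
carrier `U(J₂)`) — twinned here in §1 over the `σ₀`-generic ★ `exists_global_pole_set_of_lt` at `σ₀ = 2` (Godement abscissa of `U(2,1)`; this costs the binder `1 ≤ n₀`, vacuous at
`N = 2`, `n₀ := 1` in the spherical ★ `K2E1SphericalEisensteinMeromorphicExportsU3Global`); (b) ★ `continuous_eisensteinSeriesU_flatSectionU_cm_two` ↦ ★ `…_cm_three`.
* §1 **`chiEisenstein_meromorphic_globalPoleSet_of_balls_cm_three`** — row 13 at `N = 3`;
* §2 **`chiEisenstein_meromorphic_exports_core_of_packages_cm_three`** — THE CORE at `N = 3` ((E1)–(E5), (E4)).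
HONEST LABEL: HC_CM is proved only modulo the 7 printed citations (2 remaining named inputs: hLiu418 = `stmt-HodgeConjecture-24832`, h413 = `stmt-HodgeConjecture-24833`) until rung 0
closes; this file asserts no named fact and closes no socket; count-neutral.

## References
* [BernsteinLapid2019] J. Bernstein, E. Lapid, *On the meromorphic continuation of Eisenstein series* (2019), Thm 2.3, §2.1, §2.4, §4 pp. 9–10.
* [MoeglinWaldspurger1995] C. Mœglin, J.-L. Waldspurger, *Spectral Decomposition and Eisenstein Series* (1995), II.1.5, IV.1.8–IV.1.10.
* [Iwaniec2002] H. Iwaniec, *Spectral Methods of Automorphic Forms* (2002), §6.2.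
-/

set_option autoImplicit false
set_option linter.dupNamespace false  -- the mandated namespace repeats the summit's segment

noncomputable section

open MeasureTheory Filter Topology Set NumberField
open scoped NNReal ENNReal Classical ComplexConjugate
open Literature.MeasureTheory.Group Literature.NumberTheory Literature.NumberTheory.Automorphic Literature.NumberTheory.Automorphic.UnitaryGroup AdelicGroupData
open Summit.HodgeConjecture.HodgeConjecture.Cruxes.H413.K2E1BorelEisensteinU
open Summit.HodgeConjecture.HodgeConjecture.Cruxes.H413.K2E1BLBorelSpacesU2Defs
open Summit.HodgeConjecture.HodgeConjecture.Cruxes.H413.K2E1BLBorelOperatorsU2Defs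
open Summit.HodgeConjecture.HodgeConjecture.Cruxes.H413.K2E1BLEvaluationFunctionalU2 (exists_evalCLM)
open Summit.HodgeConjecture.HodgeConjecture.Cruxes.H413.K2E1BLLiftIntegrabilityU (quotFun_lift lift_quotientSubgroup_mul)
open Summit.HodgeConjecture.HodgeConjecture.Cruxes.H413.K2E1BLMeromorphicFamilyByproductsU (exists_global_pole_set_of_lt)
open Summit.HodgeConjecture.HodgeConjecture.Cruxes.H413.K2E1BorelEisensteinRegularCMThree (differentiableOn_eisensteinSeriesU_flatSectionU_cm_three continuous_eisensteinSeriesU_flatSectionU_cm_three)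
open Summit.HodgeConjecture.HodgeConjecture.Cruxes.H413.K2E1SphericalHeckeEigenSectionU2 (differentiable_integral_mul_borelHeight_cpow)
open Summit.HodgeConjecture.HodgeConjecture.Cruxes.H413.K2E1SphericalEisensteinCoefficientCMTwo (continuous_integral_mul_lift)

namespace Summit.HodgeConjecture.HodgeConjecture.Cruxes.H413.K2E1ChiEisensteinMeromorphicExportsU3Global

variable (L : Type) [Field L] [NumberField L] [IsCMField L]
  [MeasurableSpace (quasiSplit (↥(maximalRealSubfield L)) L (IsCMField.complexConj L) 3).Adelic] [BorelSpace (quasiSplit (↥(maximalRealSubfield L)) L (IsCMField.complexConj L) 3).Adelic]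

/-! ## §1 Row 13 at `N = 3`: one common pole set for the glued family and its coefficient pieces -/

omit [MeasurableSpace (quasiSplit (↥(maximalRealSubfield L)) L (IsCMField.complexConj L) 3).Adelic] [BorelSpace (quasiSplit (↥(maximalRealSubfield L)) L (IsCMField.complexConj L) 3).Adelic] in
/-- **ONE COMMON POLE SET FOR THE GLUED `χ`-EISENSTEIN FAMILY OF `U(2,1)_{L∕L⁺}` AND ITS COEFFICIENT PIECES** — the `N = 3` twin of ★ row 13
`K2E1ChiEisensteinMeromorphicU2.chiEisenstein_meromorphic_globalPoleSet_of_balls`: ★ `exists_global_pole_set_of_lt` at `σ₀ = 2` (the Godement abscissa of `U(2,1)`, hence the binder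
`1 ≤ n₀` for `σ₀ ≤ n₀ + 1`) over the index `G(𝔸) ⊕ J`, Godement holomorphy ★ `differentiableOn_eisensteinSeriesU_flatSectionU_cm_three`.  Conclusion = row 13's with `1 < Re ↦ 2 < Re`,
`P ⊆ {Re ≤ 2}`. [cite: BernsteinLapid2019, §2.1 and §4 p. 10] [cite: MoeglinWaldspurger1995, IV.1.8] -/
theorem chiEisenstein_meromorphic_globalPoleSet_of_balls_cm_three {φ : (quasiSplit (↥(maximalRealSubfield L)) L (IsCMField.complexConj L) 3).Adelic → ℂ} {M : ℝ} (hφM : ∀ x, ‖φ x‖ ≤ M)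
    (n₀ : ℕ) (hn₀ : 1 ≤ n₀) {J : Type*} {q : J → ℂ → ℂ} (hq : ∀ j, DifferentiableOn ℂ (q j) {z : ℂ | 2 < z.re})
    {U : ℕ → Set ℂ} (hU : ∀ n : ℕ, n₀ ≤ n → ∀ z₀ ∈ Metric.ball (0 : ℂ) (n + 2), ∀ᶠ s in 𝓝[≠] z₀, s ∈ U n)
    {F : (quasiSplit (↥(maximalRealSubfield L)) L (IsCMField.complexConj L) 3).Adelic → ℕ → ℂ → ℂ}
    (hF : ∀ g (n : ℕ), n₀ ≤ n → MeromorphicOn (F g n) (Metric.ball (0 : ℂ) (n + 2)))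
    (hFE : ∀ g (n : ℕ), n₀ ≤ n → ∀ z ∈ Metric.ball (0 : ℂ) (n + 2), 2 < z.re → F g n z = eisensteinSeriesU (flatSectionU φ z) g)
    (hFord : ∀ g (n : ℕ), n₀ ≤ n → ∀ z ∈ Metric.ball (0 : ℂ) (n + 2), z ∈ U n → 0 ≤ meromorphicOrderAt (F g n) z)
    {Fq : J → ℕ → ℂ → ℂ}
    (hFq : ∀ j (n : ℕ), n₀ ≤ n → MeromorphicOn (Fq j n) (Metric.ball (0 : ℂ) (n + 2)))
    (hFqq : ∀ j (n : ℕ), n₀ ≤ n → ∀ z ∈ Metric.ball (0 : ℂ) (n + 2), 2 < z.re → Fq j n z = q j z)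
    (hFqord : ∀ j (n : ℕ), n₀ ≤ n → ∀ z ∈ Metric.ball (0 : ℂ) (n + 2), z ∈ U n → 0 ≤ meromorphicOrderAt (Fq j n) z) :
    ∃ (Ec : ℂ → (quasiSplit (↥(maximalRealSubfield L)) L (IsCMField.complexConj L) 3).Adelic → ℂ) (qc : J → ℂ → ℂ) (P : Set ℂ),
      (∀ g, MeromorphicNFOn (fun z => Ec z g) univ) ∧ (∀ j, MeromorphicNFOn (qc j) univ) ∧
      (∀ z : ℂ, 2 < z.re → Ec z = eisensteinSeriesU (flatSectionU φ z)) ∧ (∀ j (z : ℂ), 2 < z.re → qc j z = q j z) ∧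
      (∀ g (n : ℕ), n₀ ≤ n → ∀ z ∈ Metric.ball (0 : ℂ) (n + 2), (fun z => Ec z g) =ᶠ[𝓝[≠] z] F g n) ∧
      (∀ j (n : ℕ), n₀ ≤ n → ∀ z ∈ Metric.ball (0 : ℂ) (n + 2), qc j =ᶠ[𝓝[≠] z] Fq j n) ∧
      IsClosed P ∧ (∀ z₀ : ℂ, ∀ᶠ s in 𝓝[≠] z₀, s ∉ P) ∧ (∀ z ∈ P, z.re ≤ 2) ∧
      (∀ z : ℂ, z ∉ P → 2 < z.re ∨ (z ∈ U (max n₀ ⌈‖z‖⌉₊) ∧ z ∈ U (max n₀ (⌈‖z‖⌉₊ + 1)))) ∧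
      (∀ g (z : ℂ), z ∉ P → AnalyticAt ℂ (fun z => Ec z g) z) ∧ (∀ j (z : ℂ), z ∉ P → AnalyticAt ℂ (qc j) z) ∧
      (∀ g, DifferentiableOn ℂ (fun z => Ec z g) Pᶜ) ∧ ∀ j, DifferentiableOn ℂ (qc j) Pᶜ := by
  -- the index `ι := G(𝔸) ⊕ J`: Eisenstein values at `g` and coefficient pieces, all scalar
  obtain ⟨gι, hgι⟩ : ∃ gι : ((quasiSplit (↥(maximalRealSubfield L)) L (IsCMField.complexConj L) 3).Adelic ⊕ J) → ℂ → ℂ,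
      gι = fun a => Sum.elim (fun g z => eisensteinSeriesU (flatSectionU φ z) g) q a := ⟨_, rfl⟩
  obtain ⟨Fι, hFι⟩ : ∃ Fι : ((quasiSplit (↥(maximalRealSubfield L)) L (IsCMField.complexConj L) 3).Adelic ⊕ J) → ℕ → ℂ → ℂ,
      Fι = fun a => Sum.elim F Fq a := ⟨_, rfl⟩
  have hgιd : ∀ a, DifferentiableOn ℂ (gι a) {z : ℂ | (2 : ℝ) < z.re} := by
    rintro (g | j)
    · rw [hgι]; exact differentiableOn_eisensteinSeriesU_flatSectionU_cm_three L hφM g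
    · rw [hgι]; exact hq j
  have hFιm : ∀ a (n : ℕ), n₀ ≤ n → MeromorphicOn (Fι a n) (Metric.ball (0 : ℂ) (n + 2)) := by
    rintro (g | j) n hn
    · rw [hFι]; exact hF g n hn
    · rw [hFι]; exact hFq j n hn
  have hFιg : ∀ a (n : ℕ), n₀ ≤ n → ∀ z ∈ Metric.ball (0 : ℂ) (n + 2), (2 : ℝ) < z.re → Fι a n z = gι a z := by
    rintro (g | j) n hn z hz hz1
    · rw [hFι, hgι]; exact hFE g n hn z hz hz1
    · rw [hFι, hgι]; exact hFqq j n hn z hz hz1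
  have hFιo : ∀ a (n : ℕ), n₀ ≤ n → ∀ z ∈ Metric.ball (0 : ℂ) (n + 2), z ∈ U n → 0 ≤ meromorphicOrderAt (Fι a n) z := by
    rintro (g | j) n hn z hz hzU
    · rw [hFι]; exact hFord g n hn z hz hzU
    · rw [hFι]; exact hFqord j n hn z hz hzU
  obtain ⟨G, P, hG, hGg, hGF, hPc, hPd, hP1, hPU, hGan, hGd⟩ :=
    exists_global_pole_set_of_lt (2 : ℝ) zero_le_two n₀ (by exact_mod_cast Nat.succ_le_succ hn₀) hgιd hU hFιm hFιg hFιo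
  refine ⟨fun z g => G (Sum.inl g) z, fun j => G (Sum.inr j), P, fun g => hG (Sum.inl g), fun j => hG (Sum.inr j), fun z hz => funext fun g => ?_, fun j z hz => ?_,
    fun g n hn z hz => ?_, fun j n hn z hz => ?_, hPc, hPd, hP1, hPU, fun g z hz => hGan (Sum.inl g) z hz, fun j z hz => hGan (Sum.inr j) z hz,
    fun g => hGd (Sum.inl g), fun j => hGd (Sum.inr j)⟩
  · have h := hGg (Sum.inl g) z hz
    rw [hgι] at h
    exact h
  · have h := hGg (Sum.inr j) z hz
    rw [hgι] at h
    exact h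
  · have h := hGF (Sum.inl g) n hn z hz
    rw [hFι] at h
    exact h
  · have h := hGF (Sum.inr j) n hn z hz
    rw [hFι] at h
    exact h

/-! ## §2 The core at `N = 3`: (E1)–(E5) and (E4), hypothesis-first on the per-ball packages -/

/-- **X2_χ CORE AT `N = 3` — THE GLOBAL BERNSTEIN–LAPID EXPORTS OF A `χ`-EISENSTEIN FAMILY OF `U(2,1)_{L∕L⁺}`, HYPOTHESIS-FIRST ON THE PER-BALL PACKAGES** — the twin of ★
`K2E1ChiEisensteinMeromorphicExportsU2Global.chiEisenstein_meromorphic_exports_core_of_packages` (`(…2) ↦ (…3)`, `1 < Re ↦ 2 < Re`, `+ (hn₀ : 1 ≤ n₀)`): §1 gluing, then (E5) the pointwise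
representation of `Ec z g` on `U n ∖ P` at the ★ P3-D evaluation functionals (rank-generic ★ `exists_evalCLM`, ★ `quotFun_lift`) and (E4) continuity of `g ↦ Ec z g` off `P` (on
`{2 < Re}` ★ `continuous_eisensteinSeriesU_flatSectionU_cm_three`; elsewhere (E5) + ★ `continuous_integral_mul_lift`).  Proof = the ★ `N = 2` proof verbatim.
[cite: BernsteinLapid2019, Thm 2.3, §2.1, §2.4 and §4 Claims 1–5 (pp. 9–10)] [cite: MoeglinWaldspurger1995, IV.1.8–IV.1.10] -/
theorem chiEisenstein_meromorphic_exports_core_of_packages_cm_three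
    (μ : Measure (quasiSplit (↥(maximalRealSubfield L)) L (IsCMField.complexConj L) 3).automorphicQuotient) [(quasiSplit (↥(maximalRealSubfield L)) L (IsCMField.complexConj L) 3).IsAutomorphicMeasure μ]
    (νG : Measure (quasiSplit (↥(maximalRealSubfield L)) L (IsCMField.complexConj L) 3).Adelic) [νG.IsHaarMeasure] [νG.IsInvInvariant] [SFinite νG]
    {φ : (quasiSplit (↥(maximalRealSubfield L)) L (IsCMField.complexConj L) 3).Adelic → ℂ} (hφc : Continuous φ) {M : ℝ} (hφM : ∀ x, ‖φ x‖ ≤ M) (n₀ : ℕ) (hn₀ : 1 ≤ n₀) (k : ℕ → ℕ)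
    -- per ball: the real test functions and the cover of the ball by their height transforms
    {I : ℕ → Type} (h : (n : ℕ) → I n → (quasiSplit (↥(maximalRealSubfield L)) L (IsCMField.complexConj L) 3).Adelic → ℂ) (hhc : ∀ n i, Continuous (h n i)) (hhs : ∀ n i, HasCompactSupport (h n i))
    (hreal : ∀ n i x, conj (h n i x) = h n i x)
    (hcov : ∀ n : ℕ, n₀ ≤ n → ∀ z ∈ Metric.ball (0 : ℂ) (n + 2), ∃ i, (∫ x, h n i x * (((borelHeight x : ℝ≥0) : ℝ) : ℂ) ^ z ∂νG) ≠ 0)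
    -- per ball: the co-discrete open holomorphy set and the vector solution, holomorphic there
    {U : ℕ → Set ℂ} (hUo : ∀ n : ℕ, n₀ ≤ n → IsOpen (U n)) (hUD : ∀ n : ℕ, n₀ ≤ n → U n ⊆ Metric.ball (0 : ℂ) (n + 2))
    (hUcd : ∀ n : ℕ, n₀ ≤ n → ∀ z₀ ∈ Metric.ball (0 : ℂ) (n + 2), ∀ᶠ s in 𝓝[≠] z₀, s ∈ U n)
    (vX : (n : ℕ) → ℂ → HX (↥(maximalRealSubfield L)) L (IsCMField.complexConj L) 3 (k n) μ) (hvXd : ∀ n : ℕ, n₀ ≤ n → DifferentiableOn ℂ (vX n) (U n))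
    -- per ball: the scalar pieces of the Eisenstein family (meromorphic, Godement agreement, order ≥ 0 on `U n`, germs in integral form)
    {F : (quasiSplit (↥(maximalRealSubfield L)) L (IsCMField.complexConj L) 3).Adelic → ℕ → ℂ → ℂ}
    (hF : ∀ g (n : ℕ), n₀ ≤ n → MeromorphicOn (F g n) (Metric.ball (0 : ℂ) (n + 2)))
    (hFE : ∀ g (n : ℕ), n₀ ≤ n → ∀ z ∈ Metric.ball (0 : ℂ) (n + 2), 2 < z.re → F g n z = eisensteinSeriesU (flatSectionU φ z) g)
    (hFord : ∀ g (n : ℕ), n₀ ≤ n → ∀ z ∈ Metric.ball (0 : ℂ) (n + 2), z ∈ U n → 0 ≤ meromorphicOrderAt (F g n) z)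
    (hgerm : ∀ g (n : ℕ), n₀ ≤ n → ∀ j, ∀ z ∈ U n, (∫ x, h n j x * (((borelHeight x : ℝ≥0) : ℝ) : ℂ) ^ z ∂νG) ≠ 0 →
      F g n =ᶠ[𝓝[≠] z] fun s => (∫ x, h n j x * (((borelHeight x : ℝ≥0) : ℝ) : ℂ) ^ s ∂νG)⁻¹ * ∫ y, h n j y * ((vX n s : HX (↥(maximalRealSubfield L)) L (IsCMField.complexConj L) 3 (k n) μ) : (quasiSplit (↥(maximalRealSubfield L)) L (IsCMField.complexConj L) 3).automorphicQuotient → ℂ) ((quasiSplit (↥(maximalRealSubfield L)) L (IsCMField.complexConj L) 3).toAutomorphicQuotient (g * y)⁻¹) ∂νG)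
    -- the coefficient pieces (scalar families, ★ row 13's clauses; §1 produces them from X1_χ ED. 2)
    {J : Type*} {q : J → ℂ → ℂ} (hq : ∀ j, DifferentiableOn ℂ (q j) {z : ℂ | 2 < z.re})
    {Fq : J → ℕ → ℂ → ℂ}
    (hFq : ∀ j (n : ℕ), n₀ ≤ n → MeromorphicOn (Fq j n) (Metric.ball (0 : ℂ) (n + 2)))
    (hFqq : ∀ j (n : ℕ), n₀ ≤ n → ∀ z ∈ Metric.ball (0 : ℂ) (n + 2), 2 < z.re → Fq j n z = q j z)
    (hFqord : ∀ j (n : ℕ), n₀ ≤ n → ∀ z ∈ Metric.ball (0 : ℂ) (n + 2), z ∈ U n → 0 ≤ meromorphicOrderAt (Fq j n) z) :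
    ∃ (Ec : ℂ → (quasiSplit (↥(maximalRealSubfield L)) L (IsCMField.complexConj L) 3).Adelic → ℂ) (qc : J → ℂ → ℂ) (P : Set ℂ),
      (∀ g, MeromorphicNFOn (fun z => Ec z g) univ) ∧ (∀ j, MeromorphicNFOn (qc j) univ) ∧
      (∀ z : ℂ, 2 < z.re → Ec z = eisensteinSeriesU (flatSectionU φ z)) ∧ (∀ j (z : ℂ), 2 < z.re → qc j z = q j z) ∧
      (∀ g (n : ℕ), n₀ ≤ n → ∀ z ∈ Metric.ball (0 : ℂ) (n + 2), (fun z => Ec z g) =ᶠ[𝓝[≠] z] F g n) ∧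
      (∀ j (n : ℕ), n₀ ≤ n → ∀ z ∈ Metric.ball (0 : ℂ) (n + 2), qc j =ᶠ[𝓝[≠] z] Fq j n) ∧
      IsClosed P ∧ (∀ z₀ : ℂ, ∀ᶠ s in 𝓝[≠] z₀, s ∉ P) ∧ (∀ z ∈ P, z.re ≤ 2) ∧
      (∀ z : ℂ, z ∉ P → 2 < z.re ∨ (z ∈ U (max n₀ ⌈‖z‖⌉₊) ∧ z ∈ U (max n₀ (⌈‖z‖⌉₊ + 1)))) ∧
      (∀ g (z : ℂ), z ∉ P → AnalyticAt ℂ (fun z => Ec z g) z) ∧ (∀ j (z : ℂ), z ∉ P → AnalyticAt ℂ (qc j) z) ∧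
      (∀ g, DifferentiableOn ℂ (fun z => Ec z g) Pᶜ) ∧ (∀ j, DifferentiableOn ℂ (qc j) Pᶜ) ∧
      -- (E5) THE POINTWISE REPRESENTATION on `U n ∖ P`
      (∀ g (n : ℕ), n₀ ≤ n → ∀ j, ∀ z ∈ U n, z ∉ P → (∫ x, h n j x * (((borelHeight x : ℝ≥0) : ℝ) : ℂ) ^ z ∂νG) ≠ 0 →
        Ec z g = (∫ x, h n j x * (((borelHeight x : ℝ≥0) : ℝ) : ℂ) ^ z ∂νG)⁻¹ * ∫ y, h n j y * ((vX n z : HX (↥(maximalRealSubfield L)) L (IsCMField.complexConj L) 3 (k n) μ) : (quasiSplit (↥(maximalRealSubfield L)) L (IsCMField.complexConj L) 3).automorphicQuotient → ℂ) ((quasiSplit (↥(maximalRealSubfield L)) L (IsCMField.complexConj L) 3).toAutomorphicQuotient (g * y)⁻¹) ∂νG) ∧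
      -- (E4) continuity in `g` off `P`
      ∀ z : ℂ, z ∉ P → Continuous (Ec z) := by
  haveI : νG.IsMulRightInvariant := by rw [← Measure.inv_eq_self νG]; infer_instance
  -- ★ row 13: the scalar gluing with ONE common pole set
  obtain ⟨Ec, qc, P, hEcNF, hqcNF, hEcE, hqcq, hEcF, hqcF, hPc, hPcd, hPre, hPU, hEan, hqan, hEdiff, hqdiff⟩ :=
    chiEisenstein_meromorphic_globalPoleSet_of_balls_cm_three L hφM n₀ hn₀ hq hUcd hF hFE hFord hFq hFqq hFqord
  -- ── (E5) NF-germ equality AT `z ∈ U n ∖ P` with `ĥ_{n,j}(z) ≠ 0` (both sides continuous at `z`, limits along `𝓝[≠] z`) ──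
  have hE5 : ∀ g (n : ℕ), n₀ ≤ n → ∀ j, ∀ z ∈ U n, z ∉ P → (∫ x, h n j x * (((borelHeight x : ℝ≥0) : ℝ) : ℂ) ^ z ∂νG) ≠ 0 →
      Ec z g = (∫ x, h n j x * (((borelHeight x : ℝ≥0) : ℝ) : ℂ) ^ z ∂νG)⁻¹ * ∫ y, h n j y * ((vX n z : HX (↥(maximalRealSubfield L)) L (IsCMField.complexConj L) 3 (k n) μ) : (quasiSplit (↥(maximalRealSubfield L)) L (IsCMField.complexConj L) 3).automorphicQuotient → ℂ) ((quasiSplit (↥(maximalRealSubfield L)) L (IsCMField.complexConj L) 3).toAutomorphicQuotient (g * y)⁻¹) ∂νG := by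
    intro g n hn j z hzU hzP hne
    have hzb : z ∈ Metric.ball (0 : ℂ) (n + 2) := hUD n hn hzU
    -- the evaluation functional of `(Re h_j, g)` (★ P3-D) and its values on the family in integral form (canonical lift, ★ `quotFun_lift`)
    obtain ⟨Λ, hΛ⟩ := exists_evalCLM μ νG (k n) (h := fun x => (h n j x).re) (Complex.continuous_re.comp (hhc n j)) ((hhs n j).comp_left Complex.zero_re) g
    have hre : ∀ x, ((((h n j x).re : ℝ)) : ℂ) = h n j x := fun x => Complex.conj_eq_iff_re.1 (hreal n j x)
    have hΛv : ∀ s, Λ (vX n s) = ∫ y, h n j y * ((vX n s : HX (↥(maximalRealSubfield L)) L (IsCMField.complexConj L) 3 (k n) μ) : (quasiSplit (↥(maximalRealSubfield L)) L (IsCMField.complexConj L) 3).automorphicQuotient → ℂ) ((quasiSplit (↥(maximalRealSubfield L)) L (IsCMField.complexConj L) 3).toAutomorphicQuotient (g * y)⁻¹) ∂νG := by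
      intro s
      have hmem : MemLp ((quasiSplit (↥(maximalRealSubfield L)) L (IsCMField.complexConj L) 3).quotFun (fun y : (quasiSplit (↥(maximalRealSubfield L)) L (IsCMField.complexConj L) 3).Adelic => ((vX n s : HX (↥(maximalRealSubfield L)) L (IsCMField.complexConj L) 3 (k n) μ) : (quasiSplit (↥(maximalRealSubfield L)) L (IsCMField.complexConj L) 3).automorphicQuotient → ℂ) ((quasiSplit (↥(maximalRealSubfield L)) L (IsCMField.complexConj L) 3).toAutomorphicQuotient y⁻¹))) 2
          (μ.withDensity fun x => (((supHeight (↥(maximalRealSubfield L)) L (IsCMField.complexConj L) 3 x)⁻¹ ^ (2 * k n) : ℝ≥0) : ℝ≥0∞)) := by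
        rw [quotFun_lift]; exact Lp.memLp (vX n s)
      have htoHX : toHX (↥(maximalRealSubfield L)) L (IsCMField.complexConj L) 3 (k n) μ (fun y : (quasiSplit (↥(maximalRealSubfield L)) L (IsCMField.complexConj L) 3).Adelic => ((vX n s : HX (↥(maximalRealSubfield L)) L (IsCMField.complexConj L) 3 (k n) μ) : (quasiSplit (↥(maximalRealSubfield L)) L (IsCMField.complexConj L) 3).automorphicQuotient → ℂ) ((quasiSplit (↥(maximalRealSubfield L)) L (IsCMField.complexConj L) 3).toAutomorphicQuotient y⁻¹)) hmem = vX n s := by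
        have key : ∀ (f : (quasiSplit (↥(maximalRealSubfield L)) L (IsCMField.complexConj L) 3).automorphicQuotient → ℂ) (hf : MemLp f 2 (μ.withDensity fun x => (((supHeight (↥(maximalRealSubfield L)) L (IsCMField.complexConj L) 3 x)⁻¹ ^ (2 * k n) : ℝ≥0) : ℝ≥0∞))),
            f = ((vX n s : HX (↥(maximalRealSubfield L)) L (IsCMField.complexConj L) 3 (k n) μ) : (quasiSplit (↥(maximalRealSubfield L)) L (IsCMField.complexConj L) 3).automorphicQuotient → ℂ) → hf.toLp f = vX n s := by
          rintro f hf rfl; exact Lp.toLp_coeFn _ _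
        exact key _ hmem (quotFun_lift _)
      have e := (hΛ (fun y : (quasiSplit (↥(maximalRealSubfield L)) L (IsCMField.complexConj L) 3).Adelic => ((vX n s : HX (↥(maximalRealSubfield L)) L (IsCMField.complexConj L) 3 (k n) μ) : (quasiSplit (↥(maximalRealSubfield L)) L (IsCMField.complexConj L) 3).automorphicQuotient → ℂ) ((quasiSplit (↥(maximalRealSubfield L)) L (IsCMField.complexConj L) 3).toAutomorphicQuotient y⁻¹)) (lift_quotientSubgroup_mul _) hmem).2
      rw [htoHX] at e
      rw [e]; simp only [hre]
    have hev : (fun z => Ec z g) =ᶠ[𝓝[≠] z] fun s => (∫ x, h n j x * (((borelHeight x : ℝ≥0) : ℝ) : ℂ) ^ s ∂νG)⁻¹ * Λ (vX n s) :=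
      (hEcF g n hn z hzb).trans ((hgerm g n hn j z hzU hne).trans (Eventually.of_forall fun s => by simp only [hΛv]))
    have hĥc : Continuous fun s : ℂ => (∫ x, h n j x * (((borelHeight x : ℝ≥0) : ℝ) : ℂ) ^ s ∂νG) := (differentiable_integral_mul_borelHeight_cpow νG (hhc n j) (hhs n j)).continuous
    have hRc : ContinuousAt (fun s => (∫ x, h n j x * (((borelHeight x : ℝ≥0) : ℝ) : ℂ) ^ s ∂νG)⁻¹ * Λ (vX n s)) z :=
      (hĥc.continuousAt.inv₀ hne).mul (Λ.continuous.continuousAt.comp ((hvXd n hn).continuousOn.continuousAt ((hUo n hn).mem_nhds hzU)))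
    have huniq := tendsto_nhds_unique ((hEan g z hzP).continuousAt.continuousWithinAt.tendsto.congr' hev) hRc.continuousWithinAt.tendsto
    rw [huniq, hΛv]
  -- ── (E4) continuity in `g` off `P`: on `{2 < Re}` it is `E(f_z^φ)` (★ regularity for bounded continuous `φ`); elsewhere (E5) at the ball `max n₀ ⌈‖z‖⌉₊` + ★ X2a `continuous_integral_mul_lift` ──
  have hball : ∀ z : ℂ, z ∈ Metric.ball (0 : ℂ) (((max n₀ ⌈‖z‖⌉₊ : ℕ) : ℝ) + 2) := fun z => by
    rw [Metric.mem_ball, dist_zero_right]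
    have h1 : ‖z‖ ≤ (⌈‖z‖⌉₊ : ℝ) := Nat.le_ceil ‖z‖
    have h2 : ((⌈‖z‖⌉₊ : ℕ) : ℝ) ≤ ((max n₀ ⌈‖z‖⌉₊ : ℕ) : ℝ) := by exact_mod_cast le_max_right n₀ ⌈‖z‖⌉₊
    linarith
  have hE4 : ∀ z : ℂ, z ∉ P → Continuous (Ec z) := by
    intro z hzP
    rcases hPU z hzP with hz1 | ⟨hzU, -⟩
    · rw [hEcE z hz1]; exact continuous_eisensteinSeriesU_flatSectionU_cm_three L hz1 hφc hφM
    · obtain ⟨j, hj⟩ := hcov (max n₀ ⌈‖z‖⌉₊) (le_max_left _ _) z (hball z)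
      rw [show Ec z = fun g => Ec z g from rfl, show (fun g => Ec z g) = _ from funext fun g => hE5 g (max n₀ ⌈‖z‖⌉₊) (le_max_left _ _) j z hzU hzP hj]
      exact continuous_const.mul (continuous_integral_mul_lift μ νG (k (max n₀ ⌈‖z‖⌉₊)) (Lp.memLp (vX (max n₀ ⌈‖z‖⌉₊) z)) (hhc _ j) (hhs _ j))
  exact ⟨Ec, qc, P, hEcNF, hqcNF, hEcE, hqcq, hEcF, hqcF, hPc, hPcd, hPre, hPU, hEan, hqan, hEdiff, hqdiff, hE5, hE4⟩

end Summit.HodgeConjecture.HodgeConjecture.Cruxes.H413.K2E1ChiEisensteinMeromorphicExportsU3Global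

end
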